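import Summits.QuantumFields.YangMills.Theorems.AllWindowsColdBoxBoxHighLinePauliRegions
import Summits.QuantumFields.YangMills.Theorems.AllWindowsColdBoxBoxHighLineSmearedFPOperator
import Mathlib.Analysis.CStarAlgebra.Matrix
import Mathlib.LinearAlgebra.Matrix.AbsoluteValue

/-!
# T-S5.4J far-region inputs: J5a `FarRegionPhiLowerBall` (4q′, the ball condition read from `χ ≠ 0`) and J5b `FPOperatorDetCrude`
# (a crude uniform bound on `|det fpOperator|`)

Planner ym-idea-2 g18, bus `ym-idea-2/INBOX.md` 2026-08-29T18:11:01Z (T-S5.4 re-typed in JACOBIAN form, «T-S5.4J»; assignments: «w5 = J5a + J5b»),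
for the XL comparison stub S5 (LINE-19 ⟨stmt-QuantumFields-24004⟩/⟨24335⟩; U5/LINE-20 ⟨24336⟩ window flagged open by the planner).  In the Jacobian
route the FAR region of the orbit integral (Pauli coordinates `A` off the sup-box `S₀`, but still on the support of the ball cut-off `χ_r`) is bounded by
the coercivity of `landauPhi` (✓T-S5.4ℓ) times a crude bound on the Faddeev–Popov determinant inserted by the BRST weight:

* (J5a) **`FarRegionPhiLowerBall`** — ✓T-S5.4q with the ball condition READ FROM `χ_r ≠ 0` (✓`linkDefect_lt_of_ballCutoff_ne_zero`: every box link of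
  `V^{pauliGauge H A}` has defect `< 4r²`) instead of a sup bound on `A`: for `V` in lattice Landau gauge with box links in the `r`-ball, `r·H ≤ c₀`, and
  `‖A x‖ ≤ π` on the interior (the chart domain = the support of `sigmaMeasure`, NOT a smallness condition), `c·‖A x₀‖² ≤ H⁴·landauPhi H (V^{pauliGauge H A})`
  at EVERY interior site `x₀`.  Proof: ✓`landauBallCoercivity` at radius `2r` with `g := 1`, `g' := pauliGauge H A` (so `c₀ = c₀(4ℓ)/2`,
  `c = c(4ℓ)·(2/π)²`, from ✓4j's lower half `(2/π)‖a‖ ≤ ‖q(expPauli a) − 1‖`), exactly as in ✓`farRegionPhiLower`.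
* (J5b) **`FPOperatorDetCrude`** — `|det (fpOperator H W)| ≤ (3n')!·C₀^{3n'}` (`3n' = |interiorSites H × Fin 3|`) for EVERY configuration `W`
  (no ball hypothesis: the entries of `fpOperator` are uniformly bounded on `SU(2)`): `C₀ = 96` from the entrywise bound
  `|fpOperator H W p q| ≤ 96` (✓`fpOperator_apply`: an entry is a component of `divDefectLin W a` for a site field `a` with `|a_z b| ≤ 1`, i.e. a sum over
  the four directions of two `imVecM` components of `pauliLinkLin = X(a)·W_e − W_e·X(a')`, whose entries are `≤ 2·(3·1 + 1·3) = 12` since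
  `|X(v)_{ij}| ≤ Σ_b |v_b| ≤ 3` and `|W_{ij}| ≤ 1` (Mathlib `entry_norm_bound_of_unitary`)), then Mathlib's Hadamard-free `Matrix.det_le`.

Tree (✓…PauliRegions, ✓…SmearedFPOperator) + Mathlib; the only definitions are the two Props; standard axioms.  HONEST LABEL: far-region inputs of
step (1b-J) of the XL stub S5; T-S5.4J, S5, U5 and the cruxes ⟨24004⟩ ⟨24335⟩ ⟨24336⟩ remain OPEN; no summit is proved; the Yang–Mills mass gap is NOT
proved by this file.  Seat ym-line-sfw-p2-w5 g21 (cell ym-idea-1).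
-/

set_option autoImplicit false

noncomputable section

open Finset
open Literature.MathematicalPhysics.QuantumFieldTheory.AxialGauge (boxEdges)
open Literature.MathematicalPhysics.QuantumFieldTheory.Balaban1983to89.B10Eq18SigmaSU2 (su2Coord)
open Literature.MathematicalPhysics.QuantumLattice (su2Quat norm_su2Quat gaugeTransformZd LGConfig ZdEdge)
open Literature.Probability.LatticeModels (Site)

namespace Summit.QuantumFields.YangMills.Theorems.AllWindowsColdBoxBoxHighLine

/-! ## The Props -/

/-- T-S5.4J / J5a **`FarRegionPhiLowerBall`** (4q′): there are `c₀, c > 0` such that for `H ≥ 1`, `0 ≤ r`, `r·H ≤ c₀`, a configuration `V` in lattice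
Landau gauge with every box link in the `r`-ball, and Pauli coordinates `A` in the chart domain (`‖A x‖ ≤ π`) whose transform `V^{pauliGauge H A}` has every
box link of defect `< 4r²` (the output of `ballCutoff H r ≠ 0`), `c·‖A x₀‖² ≤ H⁴ · landauPhi H (V^{pauliGauge H A})` at every interior site `x₀`. -/
def FarRegionPhiLowerBall : Prop :=
  ∃ c₀ c : ℝ, 0 < c₀ ∧ 0 < c ∧ ∀ H : ℕ, 1 ≤ H → ∀ r : ℝ, 0 ≤ r → r * H ≤ c₀ →
    ∀ (V : LGConfig 4 SU2) (A : ↥(interiorSites H) → EuclideanSpace ℝ (Fin 3)),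
      (∀ e ∈ boxEdges 4 (2 * H + 1), linkDefect V e ≤ r ^ 2) → InLandauGauge H V →
      (∀ e ∈ boxEdges 4 (2 * H + 1), linkDefect (gaugeTransformZd (pauliGauge H A) V) e < 4 * r ^ 2) →
      (∀ x, ‖A x‖ ≤ Real.pi) →
        ∀ x₀, c * ‖A x₀‖ ^ 2 ≤ (H : ℝ) ^ 4 * landauPhi H (gaugeTransformZd (pauliGauge H A) V)

/-- T-S5.4J / J5b **`FPOperatorDetCrude`**: a uniform bound `|det (fpOperator H W)| ≤ (3n')! · C₀^{3n'}` over all configurations `W`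
(`3n' = |interiorSites H × Fin 3|`; the proof gives `C₀ = 96`). -/
def FPOperatorDetCrude : Prop :=
  ∃ C₀ : ℝ, 0 < C₀ ∧ ∀ (H : ℕ) (W : LGConfig 4 SU2),
    |(fpOperator H W).det| ≤ (Fintype.card (↥(interiorSites H) × Fin 3)).factorial * C₀ ^ Fintype.card (↥(interiorSites H) × Fin 3)

/-! ## J5a -/

open PauliRegions in
/-- **J5a: the far-region lower bound on `landauPhi`, ball condition read from the cut-off.** -/
theorem farRegionPhiLowerBall : FarRegionPhiLowerBall := by
  obtain ⟨c₀, c, hc₀, hc, hcoer⟩ := landauBallCoercivity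
  refine ⟨c₀ / 2, c * (2 / Real.pi) ^ 2, by positivity, by positivity, ?_⟩
  intro H hH r hr hrH V A hV hLV hW hAπ x₀
  have hr2 : 0 ≤ 2 * r := by positivity
  have hr2H : 2 * r * H ≤ c₀ := by
    have hH0 : (0 : ℝ) ≤ H := by positivity
    nlinarith
  -- the hypotheses of 4ℓ for `g := 1`, `g' := pauliGauge H A`, radius `2r`
  have h1 : ∀ e ∈ boxEdges 4 (2 * H + 1), linkDefect (gaugeTransformZd (1 : Site 4 → SU2) V) e ≤ (2 * r) ^ 2 := by
    intro e he
    rw [gaugeTransformZd_one_eq_self]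
    exact (hV e he).trans (by nlinarith)
  have h2 : ∀ e ∈ boxEdges 4 (2 * H + 1), linkDefect (gaugeTransformZd (pauliGauge H A) V) e ≤ (2 * r) ^ 2 := fun e he => by
    have := hW e he; nlinarith
  have hL1 : InLandauGauge H (gaugeTransformZd (1 : Site 4 → SU2) V) := by rw [gaugeTransformZd_one_eq_self]; exact hLV
  have key := hcoer H hH (2 * r) hr2 hr2H V 1 (pauliGauge H A) (isInteriorGauge_one H) (isInteriorGauge_extendGauge _) h1 h2 hL1
  have hsingle : gaugeDist (1 : Site 4 → SU2) (pauliGauge H A) x₀ ≤ ∑ x ∈ interiorSites H, gaugeDist (1 : Site 4 → SU2) (pauliGauge H A) x :=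
    Finset.single_le_sum (fun x _ => gaugeDist_nonneg _ _ x) x₀.2
  have hx₀' := sq_norm_le_gaugeDist_pauliGauge A x₀ (hAπ x₀)
  calc c * (2 / Real.pi) ^ 2 * ‖A x₀‖ ^ 2 = c * ((2 / Real.pi) ^ 2 * ‖A x₀‖ ^ 2) := by ring
    _ ≤ c * gaugeDist (1 : Site 4 → SU2) (pauliGauge H A) x₀ := mul_le_mul_of_nonneg_left hx₀' hc.le
    _ ≤ c * ∑ x ∈ interiorSites H, gaugeDist (1 : Site 4 → SU2) (pauliGauge H A) x := mul_le_mul_of_nonneg_left hsingle hc.le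
    _ ≤ (H : ℝ) ^ 4 * landauPhi H (gaugeTransformZd (pauliGauge H A) V) := key

/-! ## J5b: entrywise bounds and the determinant -/

namespace PauliFarRegion

/-- Entries of `X(v) = su2Coord v` are bounded by `|v₀| + |v₁| + |v₂|`. -/
theorem norm_su2Coord_apply_le (v : Fin 3 → ℝ) (i j : Fin 2) : ‖su2Coord v i j‖ ≤ |v 0| + |v 1| + |v 2| := by
  have h0 := abs_nonneg (v 0)
  have h1 := abs_nonneg (v 1)
  have h2 := abs_nonneg (v 2)
  have hI : ∀ x : ℝ, ‖(x : ℂ) * Complex.I‖ = |x| := fun x => by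
    rw [norm_mul, Complex.norm_I, mul_one, Complex.norm_real, Real.norm_eq_abs]
  have hR : ∀ x : ℝ, ‖(x : ℂ)‖ = |x| := fun x => by rw [Complex.norm_real, Real.norm_eq_abs]
  fin_cases i <;> fin_cases j
  · show ‖(v 2 : ℂ) * Complex.I‖ ≤ _
    rw [hI]; linarith
  · show ‖(v 0 : ℂ) * Complex.I + v 1‖ ≤ _
    exact (norm_add_le _ _).trans (by rw [hI, hR]; linarith)
  · show ‖(v 0 : ℂ) * Complex.I - v 1‖ ≤ _
    exact (norm_sub_le _ _).trans (by rw [hI, hR]; linarith)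
  · show ‖-((v 2 : ℂ) * Complex.I)‖ ≤ _
    rw [norm_neg, hI]; linarith

/-- Entries of an `SU(2)` matrix have norm `≤ 1`. -/
theorem norm_su2_apply_le_one (W : SU2) (i j : Fin 2) : ‖(W : Matrix (Fin 2) (Fin 2) ℂ) i j‖ ≤ 1 :=
  entry_norm_bound_of_unitary (Matrix.mem_specialUnitaryGroup_iff.1 W.2).1 i j

/-- Entries of `X · W` and `W · X` for `X` with entries `≤ C` and `W ∈ SU(2)`: `≤ 2C`. -/
theorem norm_mul_apply_le {X : Matrix (Fin 2) (Fin 2) ℂ} {C : ℝ} (hX : ∀ i j, ‖X i j‖ ≤ C) (W : SU2) (i j : Fin 2) :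
    ‖(X * (W : Matrix (Fin 2) (Fin 2) ℂ)) i j‖ ≤ 2 * C ∧ ‖((W : Matrix (Fin 2) (Fin 2) ℂ) * X) i j‖ ≤ 2 * C := by
  have hC : 0 ≤ C := (norm_nonneg _).trans (hX 0 0)
  constructor
  · rw [Matrix.mul_apply, Fin.sum_univ_two]
    refine (norm_add_le _ _).trans ?_
    rw [norm_mul, norm_mul]
    have h1 := mul_le_mul (hX i 0) (norm_su2_apply_le_one W 0 j) (norm_nonneg _) hC
    have h2 := mul_le_mul (hX i 1) (norm_su2_apply_le_one W 1 j) (norm_nonneg _) hC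
    linarith
  · rw [Matrix.mul_apply, Fin.sum_univ_two]
    refine (norm_add_le _ _).trans ?_
    rw [norm_mul, norm_mul]
    have h1 := mul_le_mul (norm_su2_apply_le_one W i 0) (hX 0 j) (norm_nonneg _) zero_le_one
    have h2 := mul_le_mul (norm_su2_apply_le_one W i 1) (hX 1 j) (norm_nonneg _) zero_le_one
    linarith

/-- Components of `imVecM X` are bounded by the entries of `X`. -/
theorem abs_imVecM_le {X : Matrix (Fin 2) (Fin 2) ℂ} {C : ℝ} (hX : ∀ i j, ‖X i j‖ ≤ C) (c : Fin 3) : |imVecM X c| ≤ C := by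
  fin_cases c
  · exact (Complex.abs_im_le_norm _).trans (hX 0 0)
  · exact (Complex.abs_re_le_norm _).trans (hX 1 0)
  · exact (Complex.abs_im_le_norm _).trans (hX 1 0)

/-- **Entrywise bound `|pauliLinkLin| ≤ 12`** for a site field with all coordinates in `[−1, 1]`. -/
theorem abs_imVecM_pauliLinkLin_le (W : LGConfig 4 SU2) {a : Site 4 → EuclideanSpace ℝ (Fin 3)} (ha : ∀ z b, |a z b| ≤ 1) (e : ZdEdge 4)
    (c : Fin 3) : |imVecM (pauliLinkLin W a e) c| ≤ 12 := by
  have hX : ∀ z (i j : Fin 2), ‖su2Coord (a z) i j‖ ≤ 3 := fun z i j =>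
    (norm_su2Coord_apply_le _ i j).trans (by linarith [ha z 0, ha z 1, ha z 2])
  refine abs_imVecM_le (fun i j => ?_) c
  unfold pauliLinkLin
  rw [Matrix.sub_apply]
  refine (norm_sub_le _ _).trans ?_
  have h1 := (norm_mul_apply_le (hX e.1) (W e) i j).1
  have h2 := (norm_mul_apply_le (hX (e.1 + Pi.single e.2 1)) (W e) i j).2
  linarith

/-- **Entrywise bound `|fpOperator H W p q| ≤ 96`.** -/
theorem abs_fpOperator_apply_le (H : ℕ) (W : LGConfig 4 SU2) (p q : ↥(interiorSites H) × Fin 3) : |fpOperator H W p q| ≤ 96 := by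
  rw [fpOperator_apply, divDefectLin_apply]
  -- the coordinate field has all components in `{0, 1}`
  have ha : ∀ z b, |extPauli H (vecToField H (Pi.single q (1 : ℝ))) z b| ≤ 1 := by
    intro z b
    by_cases hz : z ∈ interiorSites H
    · rw [extPauli_of_mem _ hz, vecToField_apply, Pi.single_apply]
      split_ifs <;> simp
    · rw [extPauli_of_not_mem _ hz]
      simp
  refine (Finset.abs_sum_le_sum_abs _ _).trans ?_
  calc ∑ μ : Fin 4, |imVecM (pauliLinkLin W (extPauli H (vecToField H (Pi.single q 1))) (p.1.1 - Pi.single μ 1, μ)) p.2 -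
          imVecM (pauliLinkLin W (extPauli H (vecToField H (Pi.single q 1))) (p.1.1, μ)) p.2|
      ≤ ∑ _μ : Fin 4, (24 : ℝ) := Finset.sum_le_sum fun μ _ => (abs_sub _ _).trans (by
          linarith [abs_imVecM_pauliLinkLin_le W ha (p.1.1 - Pi.single μ 1, μ) p.2,
            abs_imVecM_pauliLinkLin_le W ha (p.1.1, μ) p.2])
    _ = 96 := by simp; norm_num

end PauliFarRegion

open PauliFarRegion

/-- **J5b: the crude determinant bound** (`C₀ = 96`, Mathlib's `Matrix.det_le`). -/
theorem fpOperatorDetCrude : FPOperatorDetCrude := by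
  refine ⟨96, by norm_num, fun H W => ?_⟩
  have h := Matrix.det_le (A := fpOperator H W) (abv := AbsoluteValue.abs) (x := (96 : ℝ)) fun i j => by
    rw [AbsoluteValue.abs_apply]; exact abs_fpOperator_apply_le H W i j
  rw [AbsoluteValue.abs_apply, nsmul_eq_mul] at h
  exact h

/-! ## Appended: the planner's typed letters (`Cruxes/BoxWindowHighSU2213/TaskS5Laplace.lean`, commit ae884a356928, published 18:19:22Z —
simultaneously with this file's first version).  The task's J5a Prop has the SAME NAME `FarRegionPhiLowerBall` as the Prop above but reads the
moved configuration's links as `≤ r²` (same radius as `V`) and orders the hypotheses `InLandauGauge → links V → links W → chart`; it is proved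
here as a theorem with the task's body VERBATIM (`farRegionPhiLowerBall_task`; a second `def` of that name is impossible).  The task's J5b Prop
`FPDetCrude` (exponential form) is copied VERBATIM and proved from `fpOperatorDetCrude` (`(3n')!·96^{3n'} ≤ exp(18·n'·(1 + log n'))`). -/

open PauliRegions in
/-- **J5a in the task's letters** (`TaskS5Laplace.lean` :135 `FarRegionPhiLowerBall`, body verbatim): ✓4ℓ at radius `r` with `g := 1`,
`g' := pauliGauge H A`, one term of the sum, ✓4j's lower half. -/
theorem farRegionPhiLowerBall_task :
    ∃ c₀ c : ℝ, 0 < c₀ ∧ 0 < c ∧ ∀ H : ℕ, 1 ≤ H → ∀ r : ℝ, 0 ≤ r → r * H ≤ c₀ →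
    ∀ (V : LGConfig 4 SU2) (A : ↥(interiorSites H) → EuclideanSpace ℝ (Fin 3)),
      InLandauGauge H V → (∀ e ∈ boxEdges 4 (2 * H + 1), linkDefect V e ≤ r ^ 2) →
      (∀ e ∈ boxEdges 4 (2 * H + 1), linkDefect (gaugeTransformZd (pauliGauge H A) V) e ≤ r ^ 2) →
      (∀ x, ‖A x‖ ≤ Real.pi) →
        ∀ x₀ : ↥(interiorSites H), c * ‖A x₀‖ ^ 2 ≤ (H : ℝ) ^ 4 * landauPhi H (gaugeTransformZd (pauliGauge H A) V) := by
  obtain ⟨c₀, c, hc₀, hc, hcoer⟩ := landauBallCoercivity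
  refine ⟨c₀, c * (2 / Real.pi) ^ 2, hc₀, by positivity, ?_⟩
  intro H hH r hr hrH V A hLV hV hW hAπ x₀
  have h1 : ∀ e ∈ boxEdges 4 (2 * H + 1), linkDefect (gaugeTransformZd (1 : Site 4 → SU2) V) e ≤ r ^ 2 := by
    intro e he; rw [gaugeTransformZd_one_eq_self]; exact hV e he
  have hL1 : InLandauGauge H (gaugeTransformZd (1 : Site 4 → SU2) V) := by rw [gaugeTransformZd_one_eq_self]; exact hLV
  have key := hcoer H hH r hr hrH V 1 (pauliGauge H A) (isInteriorGauge_one H) (isInteriorGauge_extendGauge _) h1 hW hL1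
  have hsingle : gaugeDist (1 : Site 4 → SU2) (pauliGauge H A) x₀ ≤ ∑ x ∈ interiorSites H, gaugeDist (1 : Site 4 → SU2) (pauliGauge H A) x :=
    Finset.single_le_sum (fun x _ => gaugeDist_nonneg _ _ x) x₀.2
  have hx₀' := sq_norm_le_gaugeDist_pauliGauge A x₀ (hAπ x₀)
  calc c * (2 / Real.pi) ^ 2 * ‖A x₀‖ ^ 2 = c * ((2 / Real.pi) ^ 2 * ‖A x₀‖ ^ 2) := by ring
    _ ≤ c * gaugeDist (1 : Site 4 → SU2) (pauliGauge H A) x₀ := mul_le_mul_of_nonneg_left hx₀' hc.le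
    _ ≤ c * ∑ x ∈ interiorSites H, gaugeDist (1 : Site 4 → SU2) (pauliGauge H A) x := mul_le_mul_of_nonneg_left hsingle hc.le
    _ ≤ (H : ℝ) ^ 4 * landauPhi H (gaugeTransformZd (pauliGauge H A) V) := key

/-- **J5b `FPDetCrude` (S; owner w5 or w2)** — the task's Prop VERBATIM (`TaskS5Laplace.lean` :146): `|det F(W)| ≤ exp(C·n'·(1 + log n'))`,
`n' = #interiorSites H`. -/
def FPDetCrude : Prop :=
  ∃ C : ℝ, 0 < C ∧ ∀ (H : ℕ) (W : LGConfig 4 SU2),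
    |(fpOperator H W).det| ≤ Real.exp (C * (interiorSites H).card * (1 + Real.log ((interiorSites H).card)))

/-- `288 < e⁶`. -/
theorem two88_lt_exp_six : (288 : ℝ) < Real.exp 6 := by
  have h := Real.exp_one_gt_d9
  calc (288 : ℝ) < (2.7182818283 : ℝ) ^ 6 := by norm_num
    _ < Real.exp 1 ^ 6 := pow_lt_pow_left₀ h (by norm_num) (by norm_num)
    _ = Real.exp 6 := by rw [Real.exp_one_pow]; norm_num

/-- **J5b in the task's letters: `fpDetCrude : FPDetCrude`** with `C = 18` (from `fpOperatorDetCrude`: `(3n')!·96^{3n'} ≤ (288 n')^{3n'}` and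
`log 288 < 6`). -/
theorem fpDetCrude : FPDetCrude := by
  refine ⟨18, by norm_num, fun H W => ?_⟩
  have hN : Fintype.card (↥(interiorSites H) × Fin 3) = 3 * (interiorSites H).card := by
    rw [Fintype.card_prod, Fintype.card_coe, Fintype.card_fin, mul_comm]
  have h96 := Matrix.det_le (A := fpOperator H W) (abv := AbsoluteValue.abs) (x := (96 : ℝ)) fun i j => by
    rw [AbsoluteValue.abs_apply]; exact PauliFarRegion.abs_fpOperator_apply_le H W i j
  rw [AbsoluteValue.abs_apply, nsmul_eq_mul, hN] at h96
  set n : ℕ := (interiorSites H).card with hn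
  rcases Nat.eq_zero_or_pos n with hn0 | hnpos
  · -- no interior sites: the matrix is `0 × 0`
    rw [hn0] at h96 ⊢
    simp only [Nat.cast_zero, mul_zero, zero_mul, Real.exp_zero]
    simpa using h96
  · have hn1 : (1 : ℝ) ≤ n := by exact_mod_cast hnpos
    have hlogn : 0 ≤ Real.log (n : ℝ) := Real.log_nonneg hn1
    -- (3n)! ≤ (3n)^{3n}
    have hfac : ((3 * n).factorial : ℝ) ≤ ((3 * n : ℕ) : ℝ) ^ (3 * n) := by exact_mod_cast Nat.factorial_le_pow (3 * n)
    have hpos288 : (0 : ℝ) < 288 * n := by positivity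
    calc |(fpOperator H W).det| ≤ ((3 * n).factorial : ℝ) * 96 ^ (3 * n) := h96
      _ ≤ ((3 * n : ℕ) : ℝ) ^ (3 * n) * 96 ^ (3 * n) := mul_le_mul_of_nonneg_right hfac (by positivity)
      _ = (288 * (n : ℝ)) ^ (3 * n) := by rw [← mul_pow]; push_cast; ring
      _ = Real.exp ((3 * n : ℕ) * Real.log (288 * n)) := by
          rw [← Real.exp_log (pow_pos hpos288 _), Real.log_pow]
      _ ≤ Real.exp (18 * (n : ℝ) * (1 + Real.log n)) := by
          apply Real.exp_le_exp.2
          have hlog288 : Real.log 288 < 6 := by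
            rw [Real.log_lt_iff_lt_exp (by norm_num)]; exact two88_lt_exp_six
          rw [Real.log_mul (by norm_num) (by positivity)]
          push_cast
          nlinarith [hlogn, hn1]

end Summit.QuantumFields.YangMills.Theorems.AllWindowsColdBoxBoxHighLine

end
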